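import Mathlib
import Literature.Probability.PointProcesses.LensConsistentLaw
import Literature.MathematicalPhysics.StatisticalMechanics.LennardJonesClusters
import Literature.MathematicalPhysics.StatisticalMechanics.BarlowStacking
import Literature.Probability.Process.RootedHardCoreVague
import Literature.Probability.Process.PointStationaryLaw
import Summits.AtomisticToContinuum.Crystallization.Theorems.FrustrationRangeCertificatesPatternPricedCertificatesStubLevelLift
import Summits.AtomisticToContinuum.Crystallization.Theorems.PalmUnimodularRigidityBenjaminiSchrammLimitCampbell
import HarnessLib

/-!
# Crux `PatternPricedCertificates` (stmt-AtomisticToContinuum-12974), line `registered`: stub `stub_campbellToStationary`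

Campbell identity on continuous local test functions ⇒ `IsPointStationaryLaw` of the push-forward along `S ↦ count|S`.
Bridge stub B2b of the line.
-/

noncomputable section

open scoped BigOperators Classical
open MeasureTheory

open Set Filter Metric TopologicalSpace ProbabilityTheory
open scoped Topology ENNReal NNReal BoundedContinuousFunction
open Literature.Probability.Process Literature.Probability.Process.LocalConfig
open Summit.AtomisticToContinuum.Crystallization.Theorems.BenjaminiSchrammLimit

namespace Summit.AtomisticToContinuum.Crystallization.Theorems.PatternPricedCertificates

section Campbell

variable {E : Type*} [NormedAddCommGroup E] [ProperSpace E] [MeasurableSpace E] [BorelSpace E]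
  {δ : ℝ} [Fact (0 < δ)]

/-- **Tested invariance of the Campbell measure from the Campbell identity.** If a probability law
`Q` on rooted `δ`-hard-core configurations satisfies the Campbell / re-rooting identity
`∫ Σ_{y ∈ S} G(S, y) dQ = ∫ Σ_{y ∈ S} G(S − y, −y) dQ` for every continuous bounded real `G` with
bounded `y`-support, then `∫ Φ d(Θ_* (Q ⊗ₘ κ₀)) = ∫ Φ d(Q ⊗ₘ κ₀)` for every bounded continuous
`Φ ≥ 0` vanishing for `‖y‖ > R` (`κ₀ S = count|S`, `Θ (S, y) = (S − y, −y)`): both sides are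
`Q`-integrals of bounded continuous local sums (`exists_bcf_eq_lintegral`), whose real versions are
the two sides of the identity. [folklore] -/
theorem lintegral_map_reroot_eq_of_campbell {Q : Measure (RootedHardCoreConfig E δ)}
    [IsProbabilityMeasure Q]
    (hC : ∀ G : RootedHardCoreConfig E δ × E → ℝ, Continuous G →
      (∃ R : ℝ, ∀ S y, R < ‖y‖ → G (S, y) = 0) → (∃ M : ℝ, ∀ p, |G p| ≤ M) →
      ∫ S, (∫ y, G (S, y) ∂((S.1 : LocalConfig E).toMeasure)) ∂Q =
        ∫ S, (∫ y, (if h : y ∈ ((S.1 : LocalConfig E) : Set E) then G (S.reroot y h, -y) else 0)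
          ∂((S.1 : LocalConfig E).toMeasure)) ∂Q)
    (Φ : RootedHardCoreConfig E δ × E →ᵇ ℝ≥0) {R : ℝ}
    (hR : ∀ p : RootedHardCoreConfig E δ × E, R < ‖p.2‖ → Φ p = 0) :
    ∫⁻ p, (Φ p : ℝ≥0∞) ∂((Q ⊗ₘ (⟨fun S : RootedHardCoreConfig E δ => (S.1 : LocalConfig E).toMeasure,
        measurable_toMeasure (Fact.out : 0 < δ)⟩ : Kernel (RootedHardCoreConfig E δ) E)).map
        (fun p : RootedHardCoreConfig E δ × E =>
          ((if h : p.2 ∈ ((p.1.1 : LocalConfig E) : Set E) then p.1.reroot p.2 h else p.1 :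
            RootedHardCoreConfig E δ), -p.2))) =
      ∫⁻ p, (Φ p : ℝ≥0∞) ∂(Q ⊗ₘ (⟨fun S : RootedHardCoreConfig E δ => (S.1 : LocalConfig E).toMeasure,
        measurable_toMeasure (Fact.out : 0 < δ)⟩ : Kernel (RootedHardCoreConfig E δ) E)) := by
  haveI := isSFiniteKernel_toMeasure (E := E) (δ := δ)
  have hδ : 0 < δ := Fact.out
  have hΘ : Measurable (fun p : RootedHardCoreConfig E δ × E =>
      ((if h : p.2 ∈ ((p.1.1 : LocalConfig E) : Set E) then p.1.reroot p.2 h else p.1 :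
        RootedHardCoreConfig E δ), -p.2)) := measurable_reroot hδ
  have hΦc : Continuous fun p : RootedHardCoreConfig E δ × E => (Φ p : ℝ) :=
    NNReal.continuous_coe.comp Φ.continuous
  have hΦm : Measurable fun p : RootedHardCoreConfig E δ × E => (Φ p : ℝ≥0∞) :=
    (ENNReal.continuous_coe.comp Φ.continuous).measurable
  -- the two local sums
  obtain ⟨A, hA⟩ := exists_bcf_eq_lintegral hδ (G := fun p => Φ p) Φ.continuous.continuousOn hR
  obtain ⟨B, hB⟩ := exists_bcf_eq_lintegral hδ (G := fun p => Φ
      ((if h : p.2 ∈ ((p.1.1 : LocalConfig E) : Set E) then p.1.reroot p.2 h else p.1 :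
        RootedHardCoreConfig E δ), -p.2))
    (Φ.continuous.comp_continuousOn continuousOn_reroot) (R := R) fun p hp =>
      hR _ (by dsimp only; rwa [norm_neg])
  have hIA : ∫⁻ p, (Φ p : ℝ≥0∞) ∂(Q ⊗ₘ (⟨fun S : RootedHardCoreConfig E δ =>
      (S.1 : LocalConfig E).toMeasure, measurable_toMeasure (Fact.out : 0 < δ)⟩ :
        Kernel (RootedHardCoreConfig E δ) E)) = ∫⁻ S, (A S : ℝ≥0∞) ∂Q := by
    rw [Measure.lintegral_compProd hΦm]
    exact lintegral_congr fun S => (hA S).symm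
  have hIB : ∫⁻ p, (Φ p : ℝ≥0∞) ∂((Q ⊗ₘ (⟨fun S : RootedHardCoreConfig E δ =>
      (S.1 : LocalConfig E).toMeasure, measurable_toMeasure (Fact.out : 0 < δ)⟩ :
        Kernel (RootedHardCoreConfig E δ) E)).map
        (fun p : RootedHardCoreConfig E δ × E =>
          ((if h : p.2 ∈ ((p.1.1 : LocalConfig E) : Set E) then p.1.reroot p.2 h else p.1 :
            RootedHardCoreConfig E δ), -p.2))) = ∫⁻ S, (B S : ℝ≥0∞) ∂Q := by
    rw [lintegral_map hΦm hΘ, Measure.lintegral_compProd (f := fun p : RootedHardCoreConfig E δ × E =>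
      (Φ ((if h : p.2 ∈ ((p.1.1 : LocalConfig E) : Set E) then p.1.reroot p.2 h else p.1 :
        RootedHardCoreConfig E δ), -p.2) : ℝ≥0∞)) (hΦm.comp hΘ)]
    exact lintegral_congr fun S => (hB S).symm
  rw [hIA, hIB, ← ENNReal.toReal_eq_toReal_iff' (B.lintegral_lt_top_of_nnreal Q).ne
    (A.lintegral_lt_top_of_nnreal Q).ne, A.toReal_lintegral_coe_eq_integral Q,
    B.toReal_lintegral_coe_eq_integral Q]
  -- the real versions of the two local sums
  have hA' : ∀ S : RootedHardCoreConfig E δ,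
      (A S : ℝ) = ∫ y, (Φ (S, y) : ℝ) ∂((S.1 : LocalConfig E).toMeasure) := fun S => by
    rw [integral_eq_lintegral_of_nonneg_ae (Eventually.of_forall fun y => NNReal.coe_nonneg _)
      (hΦc.comp (Continuous.prodMk_right S)).measurable.aestronglyMeasurable]
    simp_rw [ENNReal.ofReal_coe_nnreal]
    rw [← hA S, ENNReal.coe_toReal]
  have hB' : ∀ S : RootedHardCoreConfig E δ,
      (B S : ℝ) = ∫ y, (if h : y ∈ ((S.1 : LocalConfig E) : Set E) then (Φ (S.reroot y h, -y) : ℝ)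
        else 0) ∂((S.1 : LocalConfig E).toMeasure) := fun S => by
    have h1 : ∫ y, (if h : y ∈ ((S.1 : LocalConfig E) : Set E) then (Φ (S.reroot y h, -y) : ℝ)
        else 0) ∂((S.1 : LocalConfig E).toMeasure) = ∫ y, (Φ
          ((if h : (S, y).2 ∈ (((S, y).1.1 : LocalConfig E) : Set E) then (S, y).1.reroot (S, y).2 h
            else (S, y).1 : RootedHardCoreConfig E δ), -(S, y).2) : ℝ)
          ∂((S.1 : LocalConfig E).toMeasure) := by
      rw [toMeasure_def]
      refine setIntegral_congr_fun (RootedHardCoreConfig.isClosed_coe hδ S).measurableSet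
        fun y hy => ?_
      simp only [dif_pos hy]
    rw [h1, integral_eq_lintegral_of_nonneg_ae (Eventually.of_forall fun y => NNReal.coe_nonneg _)
      ((hΦc.measurable.comp hΘ).comp measurable_prodMk_left).aestronglyMeasurable]
    simp_rw [ENNReal.ofReal_coe_nnreal]
    rw [← hB S, ENNReal.coe_toReal]
  simp_rw [hA', hB']
  exact (hC (fun p => (Φ p : ℝ)) hΦc ⟨R, fun S y hy => by simp [hR (S, y) hy]⟩
    ⟨(nndist Φ 0 : ℝ), fun p => by
      rw [NNReal.abs_eq]; exact_mod_cast BoundedContinuousFunction.NNReal.upper_bound Φ p⟩).symm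

/-- **A Campbell measure tested-invariant under re-rooting is invariant** (`δ > 0`, `E` proper): if
`∫ Φ d(Θ_* (Q ⊗ₘ κ₀)) = ∫ Φ d(Q ⊗ₘ κ₀)` for every bounded continuous `Φ ≥ 0` vanishing for
`‖y‖ > R` (all `R`), then `Θ_* (Q ⊗ₘ κ₀) = Q ⊗ₘ κ₀`. The closed sets bounded in the `E`-coordinate
form a generating π-system on which both (locally finite) measures are limits of integrals of
thickened indicators (`tendsto_lintegral_thickenedIndicator_of_isClosed`), which are such `Φ`
(the argument of `map_reroot_compProd_eq_of_tendsto`). [folklore] -/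
theorem map_reroot_compProd_eq_of_forall_lintegral_eq {Q : Measure (RootedHardCoreConfig E δ)}
    [IsProbabilityMeasure Q]
    (heq : ∀ (Φ : RootedHardCoreConfig E δ × E →ᵇ ℝ≥0) (R : ℝ),
      (∀ p : RootedHardCoreConfig E δ × E, R < ‖p.2‖ → Φ p = 0) →
      ∫⁻ p, (Φ p : ℝ≥0∞) ∂((Q ⊗ₘ (⟨fun S : RootedHardCoreConfig E δ =>
        (S.1 : LocalConfig E).toMeasure, measurable_toMeasure (Fact.out : 0 < δ)⟩ :
          Kernel (RootedHardCoreConfig E δ) E)).map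
        (fun p : RootedHardCoreConfig E δ × E =>
          ((if h : p.2 ∈ ((p.1.1 : LocalConfig E) : Set E) then p.1.reroot p.2 h else p.1 :
            RootedHardCoreConfig E δ), -p.2))) =
      ∫⁻ p, (Φ p : ℝ≥0∞) ∂(Q ⊗ₘ (⟨fun S : RootedHardCoreConfig E δ =>
        (S.1 : LocalConfig E).toMeasure, measurable_toMeasure (Fact.out : 0 < δ)⟩ :
          Kernel (RootedHardCoreConfig E δ) E))) :
    (Q ⊗ₘ (⟨fun S : RootedHardCoreConfig E δ => (S.1 : LocalConfig E).toMeasure,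
        measurable_toMeasure (Fact.out : 0 < δ)⟩ : Kernel (RootedHardCoreConfig E δ) E)).map
        (fun p : RootedHardCoreConfig E δ × E =>
          ((if h : p.2 ∈ ((p.1.1 : LocalConfig E) : Set E) then p.1.reroot p.2 h else p.1 :
            RootedHardCoreConfig E δ), -p.2)) =
      Q ⊗ₘ (⟨fun S : RootedHardCoreConfig E δ => (S.1 : LocalConfig E).toMeasure,
        measurable_toMeasure (Fact.out : 0 < δ)⟩ : Kernel (RootedHardCoreConfig E δ) E) := by
  haveI := isSFiniteKernel_toMeasure (E := E) (δ := δ)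
  have hδ : 0 < δ := Fact.out
  have hΘ : Measurable (fun p : RootedHardCoreConfig E δ × E =>
      ((if h : p.2 ∈ ((p.1.1 : LocalConfig E) : Set E) then p.1.reroot p.2 h else p.1 :
        RootedHardCoreConfig E δ), -p.2)) := measurable_reroot hδ
  -- preimages of windows under `Θ`
  have hpre : ∀ r : ℝ, (fun p : RootedHardCoreConfig E δ × E =>
      ((if h : p.2 ∈ ((p.1.1 : LocalConfig E) : Set E) then p.1.reroot p.2 h else p.1 :
        RootedHardCoreConfig E δ), -p.2)) ⁻¹' (univ ×ˢ closedBall (0 : E) r) =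
      (univ ×ˢ closedBall (0 : E) r : Set (RootedHardCoreConfig E δ × E)) := fun r => by
    ext p
    simp only [mem_preimage, mem_prod, mem_univ, true_and, mem_closedBall_zero_iff, norm_neg]
  set C : Measure (RootedHardCoreConfig E δ × E) := Q ⊗ₘ (⟨fun S : RootedHardCoreConfig E δ =>
    (S.1 : LocalConfig E).toMeasure, measurable_toMeasure (Fact.out : 0 < δ)⟩ :
      Kernel (RootedHardCoreConfig E δ) E) with hC_def
  set C' : Measure (RootedHardCoreConfig E δ × E) := C.map (fun p : RootedHardCoreConfig E δ × E =>
    ((if h : p.2 ∈ ((p.1.1 : LocalConfig E) : Set E) then p.1.reroot p.2 h else p.1 :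
      RootedHardCoreConfig E δ), -p.2)) with hC'_def
  have hfinC : ∀ r : ℝ, C (univ ×ˢ closedBall (0 : E) r) < ∞ := fun r =>
    compProd_univ_prod_closedBall_lt_top _ r
  have hfinC' : ∀ r : ℝ, C' (univ ×ˢ closedBall (0 : E) r) < ∞ := fun r => by
    rw [hC'_def, Measure.map_apply hΘ (MeasurableSet.univ.prod measurableSet_closedBall), hpre]
    exact hfinC r
  -- the generating π-system of closed sets bounded in the `E`-coordinate
  set 𝒮 : Set (Set (RootedHardCoreConfig E δ × E)) :=
    {F | IsClosed F ∧ ∃ R : ℝ, F ⊆ univ ×ˢ closedBall (0 : E) R} with h𝒮_def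
  have hB : ∀ i : ℕ, (univ ×ˢ closedBall (0 : E) i : Set (RootedHardCoreConfig E δ × E)) ∈ 𝒮 :=
    fun i => ⟨isClosed_univ.prod isClosed_closedBall, i, Subset.rfl⟩
  have hBU : (⋃ i : ℕ, (univ ×ˢ closedBall (0 : E) i : Set (RootedHardCoreConfig E δ × E))) = univ :=
    iUnion_eq_univ_iff.2 fun p => ⟨⌈‖p.2‖⌉₊, mem_univ _, mem_closedBall_zero_iff.2 (Nat.le_ceil _)⟩
  have hgen : (inferInstance : MeasurableSpace (RootedHardCoreConfig E δ × E)) =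
      MeasurableSpace.generateFrom 𝒮 := by
    rw [BorelSpace.measurable_eq (α := RootedHardCoreConfig E δ × E), borel_eq_generateFrom_isClosed]
    refine le_antisymm (MeasurableSpace.generateFrom_le fun F (hF : IsClosed F) => ?_)
      (MeasurableSpace.generateFrom_mono fun F hF => hF.1)
    have hFU : F = ⋃ i : ℕ, F ∩ univ ×ˢ closedBall (0 : E) i := by
      rw [← inter_iUnion, hBU, inter_univ]
    rw [hFU]
    exact MeasurableSet.iUnion fun i => MeasurableSpace.measurableSet_generateFrom
      ⟨hF.inter (hB i).1, i, inter_subset_right⟩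
  have hpi : IsPiSystem 𝒮 := fun F hF F' hF' _ =>
    ⟨hF.1.inter hF'.1, hF.2.imp fun R hR => inter_subset_left.trans hR⟩
  refine Measure.ext_of_generateFrom_of_iUnion 𝒮 (fun i : ℕ => univ ×ˢ closedBall (0 : E) i)
    hgen hpi hBU hB (fun i => (hfinC' i).ne) fun F hF => ?_
  obtain ⟨hFc, R, hFR⟩ := hF
  -- thickened indicators of `F`
  have hpos : ∀ m : ℕ, (0 : ℝ) < 1 / ((m : ℝ) + 1) := fun m => Nat.one_div_pos_of_nat
  set Φ : ℕ → (RootedHardCoreConfig E δ × E →ᵇ ℝ≥0) := fun m => thickenedIndicator (hpos m) F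
    with hΦ_def
  have hΦR : ∀ m, ∀ p : RootedHardCoreConfig E δ × E, R + 1 < ‖p.2‖ → Φ m p = 0 := by
    intro m p hp
    refine thickenedIndicator_zero (hpos m) F fun hmem => ?_
    obtain ⟨f, hf, hpf⟩ := mem_thickening_iff.1 hmem
    have hf2 : ‖f.2‖ ≤ R := mem_closedBall_zero_iff.1 (hFR hf).2
    have h1 : dist p f ≤ 1 := hpf.le.trans (by
      rw [div_le_one (by positivity)]; linarith [(Nat.cast_nonneg m : (0 : ℝ) ≤ m)])
    have h2 : dist p.2 f.2 ≤ dist p f := by rw [Prod.dist_eq]; exact le_max_right _ _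
    have h3 : ‖p.2‖ ≤ ‖f.2‖ + dist p.2 f.2 := by
      rw [dist_eq_norm]; linarith [norm_le_norm_add_norm_sub' p.2 f.2]
    linarith
  have hsupp : ∀ m, Function.support (fun p => (Φ m p : ℝ≥0∞)) ⊆
      univ ×ˢ closedBall (0 : E) (R + 1) := fun m p hp => by
    refine ⟨mem_univ _, mem_closedBall_zero_iff.2 (not_lt.1 fun hlt => hp ?_)⟩
    simp [hΦR m p hlt]
  have hFsub : F ⊆ univ ×ˢ closedBall (0 : E) (R + 1) := fun f hf =>
    ⟨mem_univ _, mem_closedBall_zero_iff.2 ((mem_closedBall_zero_iff.1 (hFR hf).2).trans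
      (by linarith))⟩
  -- for both measures, the integrals of `Φ m` converge to the measure of `F`
  have hlimit : ∀ ν : Measure (RootedHardCoreConfig E δ × E),
      ν (univ ×ˢ closedBall (0 : E) (R + 1)) < ∞ →
      Tendsto (fun m => ∫⁻ p, (Φ m p : ℝ≥0∞) ∂ν) atTop (𝓝 (ν F)) := by
    intro ν hν
    haveI : IsFiniteMeasure (ν.restrict (univ ×ˢ closedBall (0 : E) (R + 1))) :=
      ⟨by rw [Measure.restrict_apply_univ]; exact hν⟩
    have h := tendsto_lintegral_thickenedIndicator_of_isClosed
      (ν.restrict (univ ×ˢ closedBall (0 : E) (R + 1))) hFc hpos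
      tendsto_one_div_add_atTop_nhds_zero_nat
    rw [Measure.restrict_eq_self ν hFsub] at h
    refine h.congr fun m => ?_
    exact setLIntegral_eq_of_support_subset (hsupp m)
  refine tendsto_nhds_unique (hlimit _ (hfinC' _)) ?_
  have heq' : ∀ m, ∫⁻ p, (Φ m p : ℝ≥0∞) ∂C' = ∫⁻ p, (Φ m p : ℝ≥0∞) ∂C := fun m =>
    heq (Φ m) (R + 1) (hΦR m)
  simp_rw [heq']
  exact hlimit _ (hfinC _)

end Campbell

/-- **Stub B2b (Campbell identity ⇒ point-stationarity of the pushed-forward law).** If a probability law `Q` on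
rooted `δ`-hard-core configurations satisfies the Campbell identity of `stub_meanCampbell` for all continuous bounded
`G` with bounded `y`-support, then its push-forward along `S ↦ count|S` satisfies the Mecke / mass-transport identity
`IsPointStationaryLaw` (the Campbell measure `Q ⊗ count|S` restricted to `𝒳 × B̄_R` is finite and determined by such `G`;
`isPointStationaryLaw_map_toMeasure`). [folklore] -/
theorem stub_campbellToStationary :
    ∀ δ : ℝ, 0 < δ → ∀ Q : MeasureTheory.Measure (Literature.Probability.Process.LocalConfig.RootedHardCoreConfig (EuclideanSpace ℝ (Fin 3)) δ), MeasureTheory.IsProbabilityMeasure Q →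
      (∀ G : Literature.Probability.Process.LocalConfig.RootedHardCoreConfig (EuclideanSpace ℝ (Fin 3)) δ × (EuclideanSpace ℝ (Fin 3)) → ℝ, Continuous G → (∃ R : ℝ, ∀ S y, R < ‖y‖ → G (S, y) = 0) →
        (∃ M : ℝ, ∀ p, |G p| ≤ M) →
        ∫ S, (∫ y, G (S, y) ∂(Literature.Probability.Process.LocalConfig.toMeasure S.1)) ∂Q =
          ∫ S, (∫ y, (if h : y ∈ ((↑S.1 : Set (EuclideanSpace ℝ (Fin 3)))) then G (S.reroot y h, -y) else 0) ∂(Literature.Probability.Process.LocalConfig.toMeasure S.1)) ∂Q) →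
      Literature.Probability.Process.IsPointStationaryLaw (Q.map (fun S : Literature.Probability.Process.LocalConfig.RootedHardCoreConfig (EuclideanSpace ℝ (Fin 3)) δ => Literature.Probability.Process.LocalConfig.toMeasure S.1)) := by
  intro δ hδ Q hQ hC
  haveI : Fact (0 < δ) := ⟨hδ⟩
  exact isPointStationaryLaw_map_toMeasure (E := EuclideanSpace ℝ (Fin 3)) (δ := δ)
    (map_reroot_compProd_eq_of_forall_lintegral_eq fun Φ R hR =>
      lintegral_map_reroot_eq_of_campbell hC Φ hR)

end Summit.AtomisticToContinuum.Crystallization.Theorems.PatternPricedCertificates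

end
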